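import Summits.QuantumFields.BalabanUV.T4Continuum.Support.ShellMeasureRootCompositionPushCubes
import Summits.QuantumFields.BalabanUV.T4Continuum.Support.ShellMeasureWilsonLevelZero

/-!
# `T4Continuum.ShellMeasureWilsonLedger` — END-I's ONE-RUN LEVEL-0 LEDGER of the FULL `SU(2)` GIBBS MEASURE:
# (M1)₀ WITHOUT box window, WITHOUT co-tests, WITHOUT mass ratio (rows S1/S2-exterior + the on-shell transfer), fed
# slot by slot into row S17's cube-partition push — displayed binders left: per-cube two-run closeness + numerics
# (cell `pub-balaban`, sub-cell `t4`, spine estimate NE7c (node U5b); NE7c ROUND-2 crew `t4-ne7c-formalise-*`, unit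
# `b2b-balaban-t4-ne7c-formalise-leaf-06`, offered row S19 (journal FINDING F-ne7cleaf06-1 + OFFER; the owner
# t4-ne7c-p1 may renumber); ADDITIVE — imports row S17's `ShellMeasureRootCompositionPushCubes` (p208728) and row S2's
# `ShellMeasureWilsonLevelZero` (p208900; hence `…WilsonExterior` p208589, `…WilsonStraddle` p208215, row S1's
# `…WilsonGaugeInvariant` p207446) only; 0 `def`, 0 sorry, 0 cite tags)

HONEST FRAMING.  Finite four-torus programme, rung (B)+1 only — NOT infinite volume, NOT a mass gap, NOT the Clay
problem, NOT summit progress.  NE7c = `T4IndicatorShell.ShellWeightBound` is NOT PRINTED in [Balaban 1983–89] and NOT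
PROVED; «NE7c ⇐ the named binders» (trigger c3); a ONE-run level-0 ledger is NOT NE7c (two runs, live window, rate —
untouched here).  (M1) for Bałaban's inductively defined effective measures at live levels is NOT PRINTED (GAPS
G-ne7cp1-1) and asserted by nobody.  THE FINDING made kernel here (F-ne7cleaf06-1): under row S17's reading — the
pieces of a level-0 slot are pushed AFTER the partition of unity of the OTHER cubes is summed
(`ShellMeasureRootCompositionPushCubes.sum_regionDensity_mem`) — the realized measure of EVERY level-0 slot is the
FULL positive integral, the Gibbs law `e^{−β Σ_{all p}(1 − reTr U(∂p))} dU` itself, with NO co-test and NO box window;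
END-I's level-0 wall `hac` is then (M1)₀ for that un-windowed law, which FOLLOWS from the tree: row S2's exterior form of
row S1 (`ShellMeasureWilsonExterior.slotAntiConcentration_wilson_su2_exterior`, the Wilson plaquettes avoiding the chart
block riding as a blind factor) gives (M1)₀ for `1[box σ-small] · e^{−β Σ_{P_ext ∪ P_w}} dU`, and when the slot's
classifier set IS its box (B14 (2.17) TYPE: `sup_{p ⊂ □∼}`, the box = `□∼`) and `θ ≤ σ`, the window equals `1` on the
threshold shell, so `ShellMeasureWilsonStraddle.slotAntiConcentration_withDensity_of_le_on_shell` removes it with the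
SAME constant — no mass ratio, no (MR)₀ binder at level 0.  Nothing printed is asserted; every declaration is
[folklore] composition of tree theorems BY NAME.  HONEST DEPENDENCY (cell): continuum YM on T⁴ ⇐ BetaPertH ∧ nine
spine estimates (0/9 proved); BetaPertH ⇐ (D1) ∧ (D4) ∧ CAP+tail; G-an2-4 gates asym, D1 and NE2/3/4.

## What is proved (all [folklore])

* §1 `slotAntiConcentration_wilson_su2_gibbs` — (M1)₀ for the UN-WINDOWED, UN-CO-TESTED law
  `(fieldMeasure P j SU2).withDensity (e^{−β Σ_{p∈P_ext ∪ P_w}(1 − reTr U(∂p))})` and the classifier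
  `wilsonU (boxPlaqs lo hi) = max_{p ∈ box} dist1 U(∂p)`, constant row S1's `2(n + β·#P_w·8S(8+32S))/(1−δ)`, under
  row S1's geometry/numerics (non-wrapping box of side `≤ m`, chart bonds `Λ` = box bonds off the axial comb, window
  `0 < S ≤ 1/8`, `3S² < π²`, reach `(d−1)·m·σ ≤ 2S/π`, `β ≥ 0`, `0 < θ`, `0 ≤ δ < 1`, `0 ≤ ρ ≤ (1−δ)/2`, (SM)₀, (SM)_σ)
  plus `θ ≤ σ`, `P_ext` avoiding `Λ` and disjoint from `P_w`; `…_gibbs_of_union` — the same for any plaquette set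
  `P_all = P_ext ∪ P_w` (e.g. ALL plaquettes of the torus: the level-0 Gibbs measure).
* §2 `levelLedger_wilson_su2_levelZero` — row S17's `levelLedger_levelZero_cubes` for a finite family of cubes `C K`
  (boxes `[lo s, hi s]` with their data) on ONE lattice `(P, j)`, realized measure of every slot THE SAME Gibbs law
  `e^{−β Σ_{P_all}} dU`, tested variables `u^A K t s = wilsonU (box s)`, per-slot (M1)₀ from §1 raised to a uniform
  `D₀` by `T4ShellMeasureFibre.slotAntiConcentration_mono`.  DISPLAYED binders left: the other run's measurable tested
  variables `u^B` and the per-cube a.e. closeness `|u^A_s − u^B_s| ≤ ρ₀θ₀` (node U1b at level 0), the numerics, and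
  `D_s ≤ D₀` — NO (M1) binder, NO mass ratio.

WHAT THIS DOES NOT DO.  One lattice, constant in `K` and `t` (the `K`-indexed family of lattices and a bounded source
insertion are the same proof pointwise, not written); the slot COUNT `#(C K)` in `ω K = #(C K)·D₀ρ₀` is (W1)/row S9's;
no live level, no second run's ledger from run B's OWN measure (apply §2 with the roles exchanged), no rate; terms with
a large-field cube keep unrefined `ζ^A` factors (NE7b's bad class, cf. S17); NE7c NOT proved; 0/9 spine.
-/

noncomputable section

open Set Function MeasureTheory Finset

namespace Summit.QuantumFields.BalabanUV.T4Continuum.ShellMeasureWilsonLedger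

open scoped ENNReal
open Literature.MathematicalPhysics.QuantumFieldTheory.Balaban1983to89
open T4ShellMeasure (SlotAntiConcentration)
open T4ShellMeasureLevels (LevelLedger)
open T4CubeChartGnomonic (SU2)
open T4AxialGaugeFixing (combBonds)
open T4AxialGaugeSmallField (boxPlaqs boxBonds)
open ShellMeasureWilsonRealizedSU2 (wilsonU measurable_wilsonU measurable_wilsonSum wilsonSum_nonneg)
open ShellMeasureWilsonGaugeInvariant (boxTest giF measurable_giF)
open ShellMeasureWilsonStraddle (slotAntiConcentration_withDensity_of_le_on_shell wilsonU_lt_iff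
  plaqSmallOn_mono_threshold plaqSmallOn_anti)
open ShellMeasureWilsonExterior (slotAntiConcentration_wilson_su2_exterior gaugeInvariant_wilsonWeight
  wilsonSum_updateFinset_of_avoids)
open ShellMeasureWilsonLevelZero (wilsonWeight_mul_eq_union)
open ShellMeasureRootCompositionPushCubes (regionWeight regionShell regionPiece levelLedger_levelZero_cubes)

variable {P : Params} {j : ℕ} [DecidableEq (PBond P j)]

/-! ## §1 (M1)₀ for the un-windowed, un-co-tested level-0 Gibbs law -/

section Gibbs

variable [DecidableEq (Plaq P j)]

/-- **(M1)₀ FOR THE FULL LEVEL-0 GIBBS LAW — NO WINDOW, NO CO-TESTS, NO MASS RATIO.**  Row S1's data: a non-wrapping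
box `[lo, hi]` of side `≤ m`, chart bonds `Λ` (box bonds off the axial comb, the comb covering the rest of the box),
an enumeration `e` of the `n = 3·#Λ` chart coordinates, window `0 < S ≤ 1/8` with `3S² < π²`, co-test threshold `σ > 0`
with the reach condition `(d−1)·m·σ ≤ 2S/π`, weight plaquettes `P_w`, `β ≥ 0`, `θ > 0`, `0 ≤ δ < 1`,
`0 ≤ ρ ≤ (1−δ)/2`, (SM)₀, (SM)_σ; PLUS: the slot's classifier plaquettes `P_u` (nonempty, inside the box) COVER the box
(`boxPlaqs lo hi ⊆ P_u`, B14 (2.17) TYPE: the box is `□∼` itself), `θ ≤ σ`, and exterior Wilson plaquettes `P_ext` AVOIDING `Λ`, disjoint from `P_w`.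
CONCLUSION: `SlotAntiConcentration ((fieldMeasure P j SU2).withDensity (e^{−β Σ_{p∈P_ext ∪ P_w}(1 − reTr U(∂p))}))
(wilsonU P_u) θ ρ (2(n + β·#P_w·8S(8+32S))/(1−δ))`.  Proof: `slotAntiConcentration_wilson_su2_exterior`
with the blind factor `G = e^{−β Σ_{P_ext}}`, then the box window is removed by
`slotAntiConcentration_withDensity_of_le_on_shell` — on the shell `wilsonU < θ ≤ σ` forces `box σ-small`. [folklore] -/
theorem slotAntiConcentration_wilson_su2_gibbs
    {lo hi : Fin P.d → ℤ} {m : ℕ} (hN : ∀ κ, hi κ - lo κ < P.sitesPerDir j) (hm : ∀ κ, hi κ ≤ lo κ + m)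
    (Λ : Finset (PBond P j)) (hΛbox : ∀ b ∈ Λ, b ∈ boxBonds lo hi)
    (hΛcomb : Disjoint Λ (combBonds lo hi))
    (hcov : ∀ b ∈ boxBonds lo hi, b ∉ Λ → b ∈ (combBonds lo hi : Finset (PBond P j)))
    {n : ℕ} (e : ↥Λ × Fin 3 ≃ Fin n)
    {S σ : ℝ} (hS : 0 < S) (hS8 : S ≤ 1 / 8) (hSπ : 3 * S ^ 2 < Real.pi ^ 2) (hσ : 0 < σ)
    (hrad : ((P.d - 1 : ℕ) : ℝ) * m * σ ≤ 2 * S / Real.pi)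
    {Pu : Finset (Plaq P j)} (hPu : Pu.Nonempty) (hPubox : ∀ p ∈ Pu, p ∈ boxPlaqs lo hi)
    (hboxPu : boxPlaqs lo hi ⊆ (↑Pu : Set (Plaq P j)))
    (Pw Pext : Finset (Plaq P j)) {β θ δ ρ : ℝ} (hβ : 0 ≤ β) (hθ : 0 < θ) (hθσ : θ ≤ σ) (hδ0 : 0 ≤ δ)
    (hδ1 : δ < 1) (hρ0 : 0 ≤ ρ) (hρ : ρ ≤ (1 - δ) / 2) (hSM : 4 * (8 * S) ^ 2 * Real.exp (2 * (8 * S)) ≤ δ * θ)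
    (hSMσ : 4 * (8 * S) ^ 2 * Real.exp (2 * (8 * S)) ≤ δ * σ)
    (hPext : ∀ p ∈ Pext, (⟨p.src, p.μ⟩ : PBond P j) ∉ Λ ∧ (⟨p.src.shift p.μ, p.ν⟩ : PBond P j) ∉ Λ ∧
      (⟨p.src.shift p.ν, p.μ⟩ : PBond P j) ∉ Λ ∧ (⟨p.src, p.ν⟩ : PBond P j) ∉ Λ)
    (hdisj : Disjoint Pext Pw) :
    SlotAntiConcentration
      ((fieldMeasure P j SU2).withDensity fun U =>
        ENNReal.ofReal (Real.exp (-(β * ∑ p ∈ Pext ∪ Pw, (1 - reTr (GaugeField.plaqHol U p))))))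
      (wilsonU hPu) θ ρ (2 * ((n : ℝ) + β * ∑ _p ∈ Pw, (8 * S) * (8 + 4 * (8 * S))) / (1 - δ)) := by
  -- the blind exterior Wilson factor
  set Gx : GaugeField P j SU2 → ℝ≥0∞ := fun U =>
    ENNReal.ofReal (Real.exp (-(β * ∑ p ∈ Pext, (1 - reTr (GaugeField.plaqHol U p))))) with hGx
  have hGm : Measurable Gx :=
    ENNReal.measurable_ofReal.comp (Real.measurable_exp.comp (measurable_const.mul (measurable_wilsonSum Pext)).neg)
  have hGi : GaugeField.GaugeInvariant Gx := gaugeInvariant_wilsonWeight β Pext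
  have hGb : ∀ U y, Gx (updateFinset U Λ y) = Gx U := fun U y => by
    simp only [hGx, wilsonSum_updateFinset_of_avoids Λ hPext]
  have hG1 : ∀ U, Gx U ≤ 1 := fun U => by
    rw [hGx, ENNReal.ofReal_le_one, Real.exp_le_one_iff, neg_nonpos]
    exact mul_nonneg hβ (wilsonSum_nonneg Pext U)
  -- (M1)₀ for the box-windowed law with the blind factor (row S2's exterior form of row S1)
  have h' := slotAntiConcentration_wilson_su2_exterior hN hm Λ hΛbox hΛcomb hcov e hS hS8 hSπ hσ hrad hPu hPubox Pw
    hβ hθ hδ0 hδ1 hρ0 hρ hSM hSMσ hGm hGi hGb hG1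
  -- remove the window on the shell
  refine slotAntiConcentration_withDensity_of_le_on_shell (fieldMeasure P j SU2)
    (hGm.mul (measurable_giF lo hi σ β Pw)) h' (fun U => ?_) (fun U _ hUθ => ?_)
  · -- `G · giF ≤ e^{−β Σ_{P_ext ∪ P_w}}` everywhere
    show Gx U * giF lo hi σ β Pw U ≤ _
    rw [hGx, giF, mul_left_comm, ← wilsonWeight_mul_eq_union hdisj]
    exact mul_le_of_le_one_left bot_le (indicator_apply_le' (fun _ => le_rfl) fun _ => zero_le_one)
  · -- on the shell the box test passes: `wilsonU U < θ ≤ σ`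
    show _ ≤ Gx U * giF lo hi σ β Pw U
    have hmem : U ∈ boxTest lo hi σ :=
      plaqSmallOn_mono_threshold hθσ (plaqSmallOn_anti hboxPu ((wilsonU_lt_iff hPu).1 hUθ))
    rw [hGx, giF, indicator_of_mem hmem, Pi.one_apply, one_mul, wilsonWeight_mul_eq_union hdisj]

/-- **… FOR ANY PLAQUETTE SET SPLIT BY THE BLOCK**: with `P_all = P_ext ∪ P_w` (e.g. ALL plaquettes of the torus —
the level-0 Gibbs measure `e^{−β S_W} dU`), the same conclusion for `e^{−β Σ_{p∈P_all}} dU`. [folklore] -/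
theorem slotAntiConcentration_wilson_su2_gibbs_of_union
    {lo hi : Fin P.d → ℤ} {m : ℕ} (hN : ∀ κ, hi κ - lo κ < P.sitesPerDir j) (hm : ∀ κ, hi κ ≤ lo κ + m)
    (Λ : Finset (PBond P j)) (hΛbox : ∀ b ∈ Λ, b ∈ boxBonds lo hi)
    (hΛcomb : Disjoint Λ (combBonds lo hi))
    (hcov : ∀ b ∈ boxBonds lo hi, b ∉ Λ → b ∈ (combBonds lo hi : Finset (PBond P j)))
    {n : ℕ} (e : ↥Λ × Fin 3 ≃ Fin n)
    {S σ : ℝ} (hS : 0 < S) (hS8 : S ≤ 1 / 8) (hSπ : 3 * S ^ 2 < Real.pi ^ 2) (hσ : 0 < σ)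
    (hrad : ((P.d - 1 : ℕ) : ℝ) * m * σ ≤ 2 * S / Real.pi)
    {Pu : Finset (Plaq P j)} (hPu : Pu.Nonempty) (hPubox : ∀ p ∈ Pu, p ∈ boxPlaqs lo hi)
    (hboxPu : boxPlaqs lo hi ⊆ (↑Pu : Set (Plaq P j)))
    (Pw Pext Pall : Finset (Plaq P j)) {β θ δ ρ : ℝ} (hβ : 0 ≤ β) (hθ : 0 < θ) (hθσ : θ ≤ σ) (hδ0 : 0 ≤ δ)
    (hδ1 : δ < 1) (hρ0 : 0 ≤ ρ) (hρ : ρ ≤ (1 - δ) / 2) (hSM : 4 * (8 * S) ^ 2 * Real.exp (2 * (8 * S)) ≤ δ * θ)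
    (hSMσ : 4 * (8 * S) ^ 2 * Real.exp (2 * (8 * S)) ≤ δ * σ)
    (hPext : ∀ p ∈ Pext, (⟨p.src, p.μ⟩ : PBond P j) ∉ Λ ∧ (⟨p.src.shift p.μ, p.ν⟩ : PBond P j) ∉ Λ ∧
      (⟨p.src.shift p.ν, p.μ⟩ : PBond P j) ∉ Λ ∧ (⟨p.src, p.ν⟩ : PBond P j) ∉ Λ)
    (hdisj : Disjoint Pext Pw) (hall : Pext ∪ Pw = Pall) :
    SlotAntiConcentration
      ((fieldMeasure P j SU2).withDensity fun U =>
        ENNReal.ofReal (Real.exp (-(β * ∑ p ∈ Pall, (1 - reTr (GaugeField.plaqHol U p))))))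
      (wilsonU hPu) θ ρ (2 * ((n : ℝ) + β * ∑ _p ∈ Pw, (8 * S) * (8 + 4 * (8 * S))) / (1 - δ)) := by
  rw [← hall]
  exact slotAntiConcentration_wilson_su2_gibbs hN hm Λ hΛbox hΛcomb hcov e hS hS8 hSπ hσ hrad hPu hPubox hboxPu Pw Pext
    hβ hθ hθσ hδ0 hδ1 hρ0 hρ hSM hSMσ hPext hdisj

end Gibbs

/-! ## §2 END-I's one-run level-0 ledger of the Gibbs measure: all cubes, (M1)₀ discharged -/

section Ledger

variable [DecidableEq (Plaq P j)] {σ₀ : Type*} [DecidableEq σ₀]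

/-- **THE LEVEL-0 ONE-RUN LEDGER OF THE `SU(2)` GIBBS MEASURE ⇐ CLOSENESS + NUMERICS ONLY.**  ONE lattice `(P, j)`;
slots `s : σ₀` with per-slot box data (`lo s, hi s`, side bound `m s`, chart bonds `Λ s` with enumeration `e s` of
`n s` coordinates, weight/exterior plaquettes `Pw s`/`Pext s` splitting THE SAME `P_all`); the cubes present at cutoff
`K` a finset `C K`; common numerics `S, σ, β, θ₀ = θ 0, δ, ρ₀ = ρ 0` as in §1; the positive integral of EVERY `(K, t)`
is the Gibbs law `μ = e^{−β Σ_{P_all}} dU`; run A's tested variable of slot `s` is `wilsonU (box s)`, run B's is any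
measurable `u^B K t s` with the a.e. closeness `|wilsonU (box s) − u^B K t s| ≤ ρ₀θ₀`; `D_s ≤ D 0` uniformly.
CONCLUSION: `T4ShellMeasureLevels.LevelLedger l₀ (K ↦ (C K).powerset) A sh C piece 0 D ρ` for row S17's families
(`regionWeight`/`regionShell`/`regionPiece` of the cube partition against `μ`) — END-I's one-run ledger with the
wall (M1)₀ DISCHARGED per slot by §1 (`T4ShellMeasureFibre.slotAntiConcentration_mono` to the uniform constant).
NOT NE7c; no window/count/rate; nothing printed asserted. [folklore] -/
theorem levelLedger_wilson_su2_levelZero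
    (lo hi : σ₀ → Fin P.d → ℤ) (m : σ₀ → ℕ) (hN : ∀ s κ, hi s κ - lo s κ < P.sitesPerDir j)
    (hm : ∀ s κ, hi s κ ≤ lo s κ + m s)
    (Λ : σ₀ → Finset (PBond P j)) (hΛbox : ∀ s, ∀ b ∈ Λ s, b ∈ boxBonds (lo s) (hi s))
    (hΛcomb : ∀ s, Disjoint (Λ s) (combBonds (lo s) (hi s)))
    (hcov : ∀ s, ∀ b ∈ boxBonds (lo s) (hi s), b ∉ Λ s → b ∈ (combBonds (lo s) (hi s) : Finset (PBond P j)))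
    (n : σ₀ → ℕ) (e : ∀ s, ↥(Λ s) × Fin 3 ≃ Fin (n s))
    {S σ : ℝ} (hS : 0 < S) (hS8 : S ≤ 1 / 8) (hSπ : 3 * S ^ 2 < Real.pi ^ 2) (hσ : 0 < σ)
    (hrad : ∀ s, ((P.d - 1 : ℕ) : ℝ) * m s * σ ≤ 2 * S / Real.pi)
    (Pu : σ₀ → Finset (Plaq P j)) (hPu : ∀ s, (Pu s).Nonempty) (hPubox : ∀ s, ∀ p ∈ Pu s, p ∈ boxPlaqs (lo s) (hi s))
    (hboxPu : ∀ s, boxPlaqs (lo s) (hi s) ⊆ (↑(Pu s) : Set (Plaq P j)))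
    (Pw Pext : σ₀ → Finset (Plaq P j)) (Pall : Finset (Plaq P j)) {β δ : ℝ} {θ ρ D : ℕ → ℝ} (hβ : 0 ≤ β)
    (hθ : 0 < θ 0) (hθσ : θ 0 ≤ σ) (hδ0 : 0 ≤ δ) (hδ1 : δ < 1) (hρ0 : ∀ i, 0 ≤ ρ i) (hρ : ρ 0 ≤ (1 - δ) / 2)
    (hSM : 4 * (8 * S) ^ 2 * Real.exp (2 * (8 * S)) ≤ δ * θ 0)
    (hSMσ : 4 * (8 * S) ^ 2 * Real.exp (2 * (8 * S)) ≤ δ * σ)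
    (hPext : ∀ s, ∀ p ∈ Pext s, (⟨p.src, p.μ⟩ : PBond P j) ∉ Λ s ∧ (⟨p.src.shift p.μ, p.ν⟩ : PBond P j) ∉ Λ s ∧
      (⟨p.src.shift p.ν, p.μ⟩ : PBond P j) ∉ Λ s ∧ (⟨p.src, p.ν⟩ : PBond P j) ∉ Λ s)
    (hdisj : ∀ s, Disjoint (Pext s) (Pw s)) (hall : ∀ s, Pext s ∪ Pw s = Pall)
    (hD0 : ∀ i, 0 ≤ D i)
    (hD : ∀ s, 2 * ((n s : ℝ) + β * ∑ _p ∈ Pw s, (8 * S) * (8 + 4 * (8 * S))) / (1 - δ) ≤ D 0)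
    -- the run's cubes per cutoff, the other run's tested variables, the closeness (node U1b at level 0)
    (C : ℕ → Finset σ₀) {l₀ : ℝ} (uB : ℕ → ℝ → σ₀ → GaugeField P j SU2 → ℝ) (huB : ∀ K t s, Measurable (uB K t s))
    (hclose : ∀ K t, |t| ≤ l₀ → ∀ s ∈ C K,
      ∀ᵐ U ∂((fieldMeasure P j SU2).withDensity fun U =>
        ENNReal.ofReal (Real.exp (-(β * ∑ p ∈ Pall, (1 - reTr (GaugeField.plaqHol U p)))))),
        |wilsonU (hPu s) U - uB K t s U| ≤ ρ 0 * θ 0) :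
    LevelLedger l₀ (fun K => (C K).powerset)
      (fun K (_ : ℝ) => regionWeight (C K)
        ((fieldMeasure P j SU2).withDensity fun U =>
          ENNReal.ofReal (Real.exp (-(β * ∑ p ∈ Pall, (1 - reTr (GaugeField.plaqHol U p))))))
        (fun s => wilsonU (hPu s)) (θ 0))
      (fun K t => regionShell (C K)
        ((fieldMeasure P j SU2).withDensity fun U =>
          ENNReal.ofReal (Real.exp (-(β * ∑ p ∈ Pall, (1 - reTr (GaugeField.plaqHol U p))))))
        (fun s => wilsonU (hPu s)) (uB K t) (θ 0))
      C
      (fun K t => regionPiece (C K)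
        ((fieldMeasure P j SU2).withDensity fun U =>
          ENNReal.ofReal (Real.exp (-(β * ∑ p ∈ Pall, (1 - reTr (GaugeField.plaqHol U p))))))
        (fun s => wilsonU (hPu s)) (uB K t) (θ 0))
      (fun _ _ => 0) D ρ := by
  -- the Gibbs law is a finite measure (density ≤ 1 against the product Haar probability)
  haveI : IsFiniteMeasure ((fieldMeasure P j SU2).withDensity fun U =>
      ENNReal.ofReal (Real.exp (-(β * ∑ p ∈ Pall, (1 - reTr (GaugeField.plaqHol U p)))))) := by
    refine isFiniteMeasure_withDensity ?_
    refine ne_top_of_le_ne_top (measure_ne_top (fieldMeasure P j SU2) Set.univ) ?_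
    calc ∫⁻ U, ENNReal.ofReal (Real.exp (-(β * ∑ p ∈ Pall, (1 - reTr (GaugeField.plaqHol U p)))))
          ∂fieldMeasure P j SU2 ≤ ∫⁻ _U, 1 ∂fieldMeasure P j SU2 := lintegral_mono fun U => by
            rw [ENNReal.ofReal_le_one, Real.exp_le_one_iff, neg_nonpos]
            exact mul_nonneg hβ (wilsonSum_nonneg Pall U)
      _ = fieldMeasure P j SU2 Set.univ := lintegral_one
  -- (M1)₀ per slot, raised to the uniform constant `D 0`
  have hac : ∀ (K : ℕ) (t : ℝ), |t| ≤ l₀ → ∀ s ∈ C K, SlotAntiConcentration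
      ((fieldMeasure P j SU2).withDensity fun U =>
        ENNReal.ofReal (Real.exp (-(β * ∑ p ∈ Pall, (1 - reTr (GaugeField.plaqHol U p))))))
      (wilsonU (hPu s)) (θ 0) (ρ 0) (D 0) := fun K t _ s _ =>
    T4ShellMeasureFibre.slotAntiConcentration_mono (hρ0 0) (hD s)
      (slotAntiConcentration_wilson_su2_gibbs_of_union (hN s) (hm s) (Λ s) (hΛbox s) (hΛcomb s) (hcov s) (e s)
        hS hS8 hSπ hσ (hrad s) (hPu s) (hPubox s) (hboxPu s) (Pw s) (Pext s) Pall hβ hθ hθσ hδ0 hδ1 (hρ0 0) hρ hSM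
        hSMσ (hPext s) (hdisj s) (hall s))
  exact levelLedger_levelZero_cubes (μ := fun _ _ => (fieldMeasure P j SU2).withDensity fun U =>
      ENNReal.ofReal (Real.exp (-(β * ∑ p ∈ Pall, (1 - reTr (GaugeField.plaqHol U p))))))
    (uA := fun _ _ s => wilsonU (hPu s)) (fun _ _ s => measurable_wilsonU (hPu s)) huB hclose hD0 hρ0 hac

end Ledger

end Summit.QuantumFields.BalabanUV.T4Continuum.ShellMeasureWilsonLedger

end
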